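import Literature.NumberTheory.Transcendental.FischlerRivoalCorollary1Reduction
import Literature.NumberTheory.Transcendental.FischlerRivoalCorollary1Operators
import Literature.Algebra.Polynomial.DifferentialOperatorReduction
import Literature.RingTheory.PowerSeries.LaurentSeriesDerivation
import Literature.RingTheory.PowerSeries.FormalLinearODESolution
import HarnessLib

/-!
# Fischler–Rivoal's Corollary 1 from Conjecture 2 and André's regularity theorem — the formal Beukers deduction

`Literature/NumberTheory/Transcendental/FischlerRivoalCorollary1OfAndre.lean` — everything
PROVED; the only definitions are the two structure maps / derivations (`iota0`, `dee0` on
`ℂ⟦z⟧`; `iota1`, `dee1` on `ℂ((t))`, `z = 1 + t`) and the two remainder polynomials `opA`, `opB`.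
Fourth proofs file of the named fact `FischlerRivoal2024_corollary1`
(`FischlerRivoalCorollary1.lean`: Conjecture 2 ⟹ `∫₀^∞ (t+α)^s e^{−t} dt ∉ ℚ̄`).

MAIN THEOREM `FischlerRivoal2024_corollary1_of_andreRegularity (H) : FischlerRivoal2024_corollary1`,
where the explicit hypothesis `H` is André's theorem in its Э-form at the point `1`:
« every Э-function `𝔤 = ∑ n!·bₙ zⁿ` (strict `E`-coefficients `b`) is annihilated by a non-zero
linear differential operator `Λ = ∑_{k≤m} Λₖ(z) ∂ᵏ`, `Λₖ ∈ ℂ[z]`, `Λₘ ≠ 0`, all of whose formal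
Laurent-series solutions at `z = 1` are power series » — the consequence of
[Andre2000GevreyI] (an `E`-operator annihilates `𝔤(1/x)`; its only non-trivial singularities are
`x = 0, ∞`, so at `x = 1` there is a basis of holomorphic solutions, which by the Wronskian bound
exhausts the formal solutions) that [FischlerRivoal2024, §5.1, Proposition 4] extracts from
Beukers' method. `H` is NOT discharged here (André's theory is not in the tree); with it and with
the fact's own antecedent (Conjecture 2) the corollary is a theorem of the tree.

The deduction (Beukers' argument made formal and Ore-free), for `c = α⁻¹`, `β = 𝔣₀(1/α)`
supposed algebraic, `𝔤 = β − 𝔣(cz)`, `(z−1) g₁ = 𝔤` (Conjecture 2), `Λ` from `H` for `g₁`: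
* §5 at `z = 0` in `ℂ⟦z⟧`: `(z−1)^{m+1} Λ(g₁) = Λ̃(𝔤)` (`twistedOp_spec`) gives `Λ̃(𝔤) = 0`;
  reducing along the order-2 annihilator `N` of `𝔤` (`pow_mul_opEval_eq_of_order_two`,
  `FischlerRivoalCorollary1Operators.lean`) gives `A·𝔤 + B·𝔤′ = 0` with polynomials
  `A = opA`, `B = opB`;
* §6 such a relation forces `A = B = 0`, since otherwise `𝔣(cz)` would be a rational function
  (`antiESeries_chooseSeq_not_ratFunc`);
* §7 at `z = 1` in `ℂ((t))` (a differential field by `LaurentSeriesDerivation.lean`): the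
  power-series solution `φ₀`, `φ₀(0) = 1`, of `cz²φ′ = (scz − 1)φ` (`FormalLinearODESolution.lean`)
  solves `N`, the SAME reduction gives `Λ̃(φ₀) = A φ₀ + B φ₀′ = 0`, the SAME twist gives
  `t^{m+1} Λ(t⁻¹φ₀) = 0`, so `t⁻¹φ₀` is a Laurent solution of `Λ` at `1` with a simple pole —
  contradicting `H`;
* §8 assembly with the analytic identification of `β` (`FischlerRivoalCorollary1Proofs.lean`) and
  the Э-function `β − 𝔣(cz)` (`BinomialAntiEFunctionShift.lean`).

## References

* [FischlerRivoal2024] S. Fischler, T. Rivoal, J. Number Theory 261 (2024), §1 Corollary 1,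
  §5.1 (Proposition 4, "analogous to the end of the proof of [Beukers]"), §5.2.
* [Andre2000GevreyI] Y. André, *Séries Gevrey de type arithmétique, I. Théorèmes de pureté et de
  dualité*, Ann. of Math. 151 (2000), 705–740.
* [Beukers2006] F. Beukers, *A refined version of the Siegel–Shidlovskii theorem*, Ann. of Math.
  163 (2006), 369–379.
-/

noncomputable section

open Finset Complex
open scoped Nat

namespace Literature.NumberTheory.Transcendental


open Literature.Barriers.Schanuel Literature.RingTheory.Binomial Literature.Algebra.Polynomial
  Literature.RingTheory.PowerSeries Polynomial

variable (s : ℚ) (c β : ℂ)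

namespace FischlerRivoalCor1

/-! ### 4. The two differential `ℂ[X]`-algebras: `ℂ⟦z⟧` at `z = 0` and `ℂ((t))` at `z = 1 + t` -/

/-- The structure map at `0`: `ℂ[z] → ℂ⟦z⟧`. [folklore] -/
abbrev iota0 : Polynomial ℂ →+* PowerSeries ℂ := Polynomial.coeToPowerSeries.ringHom

/-- The derivation `d/dz` of `ℂ⟦z⟧` as an additive map. [folklore] -/
abbrev dee0 : PowerSeries ℂ →+ PowerSeries ℂ :=
  (PowerSeries.derivative ℂ : PowerSeries ℂ →ₗ[ℂ] PowerSeries ℂ).toAddMonoidHom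

/-- Unfolding `dee0`. [folklore] -/
theorem dee0_apply (f : PowerSeries ℂ) : dee0 f = PowerSeries.derivative ℂ f := rfl

/-- Leibniz rule for `dee0`. [folklore] -/
theorem dee0_leibniz (a b : PowerSeries ℂ) : dee0 (a * b) = dee0 a * b + a * dee0 b := by
  show PowerSeries.derivative ℂ (a * b) =
    PowerSeries.derivative ℂ a * b + a * PowerSeries.derivative ℂ b
  rw [(PowerSeries.derivative ℂ).leibniz, smul_eq_mul, smul_eq_mul]; ring

/-- `d/dz` is compatible with `ℂ[z] → ℂ⟦z⟧`. [folklore] -/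
theorem dee0_iota0 (p : Polynomial ℂ) : dee0 (iota0 p) = iota0 (derivative p) :=
  PowerSeries.derivative_coe p

/-- Iterates of `dee0` are iterates of `PowerSeries.derivative`. [folklore] -/
theorem iterate_dee0 (k : ℕ) (f : PowerSeries ℂ) :
    (⇑dee0)^[k] f = (⇑(PowerSeries.derivative ℂ))^[k] f := rfl

/-- The structure map at `1`: `ℂ[z] → ℂ((t))`, `z ↦ 1 + t`. [folklore] -/
abbrev iota1 : Polynomial ℂ →+* LaurentSeries ℂ :=
  (HahnSeries.ofPowerSeries ℤ ℂ).comp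
    ((Polynomial.coeToPowerSeries.ringHom : Polynomial ℂ →+* PowerSeries ℂ).comp
      (Polynomial.compRingHom (Polynomial.X + Polynomial.C 1)))

/-- The derivation `d/dt` of `ℂ((t))` as an additive map. [folklore] -/
abbrev dee1 : LaurentSeries ℂ →+ LaurentSeries ℂ :=
  (LaurentSeries.derivative ℂ : LaurentSeries ℂ →ₗ[ℂ] LaurentSeries ℂ).toAddMonoidHom

/-- Unfolding `dee1`. [folklore] -/
theorem dee1_apply (f : LaurentSeries ℂ) : dee1 f = LaurentSeries.derivative ℂ f := rfl

/-- Unfolding `iota1`: `p ↦ p(1 + t)` coerced to `ℂ((t))`. [folklore] -/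
theorem iota1_apply (p : Polynomial ℂ) :
    iota1 p = (((p.comp (Polynomial.X + Polynomial.C 1) : Polynomial ℂ) : PowerSeries ℂ) :
      LaurentSeries ℂ) := rfl

/-- Leibniz rule for `dee1` (`LaurentSeriesDerivation.lean`). [folklore] -/
theorem dee1_leibniz (a b : LaurentSeries ℂ) : dee1 (a * b) = dee1 a * b + a * dee1 b :=
  Literature.RingTheory.PowerSeries.derivative_mul a b

/-- `d/dt` is compatible with `ℂ[z] → ℂ((t))`, `z ↦ 1 + t` (chain rule with `(1+t)′ = 1`). [folklore] -/
theorem dee1_iota1 (p : Polynomial ℂ) : dee1 (iota1 p) = iota1 (derivative p) := by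
  rw [iota1_apply, iota1_apply, dee1_apply, derivative_coe_polynomial, Polynomial.derivative_comp]
  simp

/-- `z − 1 ↦ t`. [folklore] -/
theorem iota1_X_sub_C_one : iota1 (Polynomial.X - Polynomial.C 1) = HahnSeries.single 1 1 := by
  rw [iota1_apply]
  simp [HahnSeries.ofPowerSeries_X]

/-- `ℂ[z] → ℂ((t))` is injective. [folklore] -/
theorem iota1_injective : Function.Injective iota1 := by
  intro p q h
  rw [iota1_apply, iota1_apply] at h
  have h1 := HahnSeries.ofPowerSeries_injective h
  have h2 : p.comp (Polynomial.X + Polynomial.C 1) = q.comp (Polynomial.X + Polynomial.C 1) :=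
    Polynomial.coe_injective ℂ h1
  have := congrArg (fun r => r.comp (Polynomial.X - Polynomial.C 1)) h2
  simpa [Polynomial.comp_assoc] using this

/-! ### 5. At `z = 0`: a polynomial relation `A·𝔤 + B·𝔤′ = 0` from an annihilator of `g₁` -/

/-- The polynomial `A` of the reduction `n₂ᵐ · Λ̃ = A + B ∂ (mod N)`, for `Λ = ∑_{k≤m} Λₖ∂ᵏ`.
[folklore] -/
def opA (m : ℕ) (Λ : ℕ → Polynomial ℂ) : Polynomial ℂ :=
  ∑ j ∈ Finset.range (m + 1), twistedOp m Λ j * FischlerRivoalCor1.nTwo s c β ^ (m - j) *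
    (reducePair (FischlerRivoalCor1.nZero s c β) (FischlerRivoalCor1.nOne s c β)
      (FischlerRivoalCor1.nTwo s c β) j).1

/-- The polynomial `B` of the reduction `n₂ᵐ · Λ̃ = A + B ∂ (mod N)`. [folklore] -/
def opB (m : ℕ) (Λ : ℕ → Polynomial ℂ) : Polynomial ℂ :=
  ∑ j ∈ Finset.range (m + 1), twistedOp m Λ j * FischlerRivoalCor1.nTwo s c β ^ (m - j) *
    (reducePair (FischlerRivoalCor1.nZero s c β) (FischlerRivoalCor1.nOne s c β)
      (FischlerRivoalCor1.nTwo s c β) j).2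

/-- **Step at `z = 0`.** If `(z − 1)·g₁ = 𝔤` and `Λ = ∑_{k≤m} Λₖ ∂ᵏ` annihilates `g₁` in `ℂ⟦z⟧`,
then `A·𝔤 + B·𝔤′ = 0` with the polynomials `A = opA`, `B = opB` (twist by `z − 1`, then reduce
along the order-2 equation `N(𝔤) = 0`). PROVED. [cite: FischlerRivoal2024, §5.1 (Proposition 4)] -/
theorem opA_mul_add_opB_mul_eq_zero {g₁ : PowerSeries ℂ}
    (hmul : (PowerSeries.X - 1) * g₁ = antiESeries (fun n => β * deltaZero n - chooseSeq s c n))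
    {m : ℕ} {Λ : ℕ → Polynomial ℂ}
    (hann : ∑ k ∈ Finset.range (m + 1),
      (Λ k : PowerSeries ℂ) * (⇑(PowerSeries.derivative ℂ))^[k] g₁ = 0) :
    (opA s c β m Λ : PowerSeries ℂ) * antiESeries (fun n => β * deltaZero n - chooseSeq s c n)
      + (opB s c β m Λ : PowerSeries ℂ)
        * PowerSeries.derivative ℂ (antiESeries fun n => β * deltaZero n - chooseSeq s c n) = 0 := by
  set 𝔤 := antiESeries (fun n => β * deltaZero n - chooseSeq s c n) with h𝔤
  -- twist
  have htw := twistedOp_spec iota0 dee0 dee0_leibniz dee0_iota0 m Λ g₁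
  have hι : iota0 (Polynomial.X - Polynomial.C 1) * g₁ = 𝔤 := by
    rw [← hmul]; congr 1; simp
  have hann' : ∑ k ∈ Finset.range (m + 1), iota0 (Λ k) * (⇑dee0)^[k] g₁ = 0 := by
    simpa [iterate_dee0] using hann
  rw [hann', mul_zero, hι] at htw
  -- reduce along `N`
  have hN : iota0 (FischlerRivoalCor1.nTwo s c β) * dee0 (dee0 𝔤)
      + iota0 (FischlerRivoalCor1.nOne s c β) * dee0 𝔤 + iota0 (FischlerRivoalCor1.nZero s c β) * 𝔤 = 0 := by
    simpa using nOp_antiESeries_diffSeq s c β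
  have hred := pow_mul_opEval_eq_of_order_two iota0 dee0 dee0_leibniz dee0_iota0 _ _ _ hN m
    (twistedOp m Λ)
  rw [← htw, mul_zero] at hred
  have : iota0 (opA s c β m Λ) * 𝔤 + iota0 (opB s c β m Λ) * dee0 𝔤 = 0 := by
    rw [opA, opB]
    exact hred.symm
  simpa [dee0_apply] using this

/-! ### 6. No non-trivial first-order relation: `A·𝔤 + B·𝔤′ = 0` forces `A = B = 0` -/

/-- **`𝔤` satisfies no non-trivial relation `A𝔤 + B𝔤′ = 0`** (`A, B ∈ ℂ[z]`; `c ≠ 0`,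
`s ∉ ℤ_{≥0}`): combined with `cz²𝔤′ + (1−scz)𝔤 = ρ` it would make `𝔥 = β − 𝔤 = 𝔣(cz)` a rational
function. PROVED. [cite: FischlerRivoal2024, §5.2] -/
theorem eq_zero_of_mul_add_mul_derivative_eq_zero (hc : c ≠ 0) (hs : ∀ n : ℕ, (s : ℚ) ≠ n)
    {A B : Polynomial ℂ}
    (h : (A : PowerSeries ℂ) * antiESeries (fun n => β * deltaZero n - chooseSeq s c n)
      + (B : PowerSeries ℂ)
        * PowerSeries.derivative ℂ (antiESeries fun n => β * deltaZero n - chooseSeq s c n) = 0) :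
    A = 0 ∧ B = 0 := by
  set 𝔤 := antiESeries (fun n => β * deltaZero n - chooseSeq s c n) with h𝔤
  set 𝔥 := antiESeries (chooseSeq s c) with h𝔥
  have hE := antiESeries_diffSeq_ode s c β
  have hgh : 𝔤 = PowerSeries.C β - 𝔥 := antiESeries_diffSeq s c β
  rw [← h𝔤] at hE
  set Q : Polynomial ℂ := A * (Polynomial.C c * Polynomial.X ^ 2)
    - B * (1 - Polynomial.C ((s : ℂ) * c) * Polynomial.X) with hQ
  set P : Polynomial ℂ := Q * Polynomial.C β + B * FischlerRivoalCor1.rho s c β with hP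
  have hQP : (Q : PowerSeries ℂ) * 𝔥 = P := by
    simp only [hQ, hP, FischlerRivoalCor1.rho, Polynomial.coe_mul, Polynomial.coe_sub,
      Polynomial.coe_add, Polynomial.coe_C, Polynomial.coe_pow, Polynomial.coe_X, Polynomial.coe_one]
    linear_combination (-(PowerSeries.C c * PowerSeries.X ^ 2)) * h + (B : PowerSeries ℂ) * hE
      + ((A : PowerSeries ℂ) * (PowerSeries.C c * PowerSeries.X ^ 2)
          - (B : PowerSeries ℂ) * (1 - PowerSeries.C ((s : ℂ) * c) * PowerSeries.X)) * hgh
  have hQ0 : Q = 0 := antiESeries_chooseSeq_not_ratFunc s c hc hs hQP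
  have hP0 : P = 0 := by
    apply Polynomial.coe_injective ℂ
    rw [← hQP, hQ0]
    simp
  have hB : B = 0 := by
    have : B * FischlerRivoalCor1.rho s c β = 0 := by
      have := hP0; rw [hP, hQ0, zero_mul, zero_add] at this; exact this
    rcases mul_eq_zero.1 this with h1 | h1
    · exact h1
    · exact absurd h1 (FischlerRivoalCor1.rho_ne_zero s c β hc hs)
  have hA : A = 0 := by
    have : A * (Polynomial.C c * Polynomial.X ^ 2) = 0 := by
      have := hQ0; rw [hQ, hB, zero_mul, sub_zero] at this; exact this
    rcases mul_eq_zero.1 this with h1 | h1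
    · exact h1
    · exfalso
      exact (mul_ne_zero (by simpa using hc) (pow_ne_zero _ Polynomial.X_ne_zero)) h1
  exact ⟨hA, hB⟩

/-! ### 7. At `z = 1`: `A = B = 0` contradicts the regularity of `Λ` at `1` -/

/-- **Step at `z = 1`.** If `A = B = 0`, then in the Laurent series field `ℂ((t))`, `z = 1 + t`:
the power-series solution `φ₀` (`φ₀(0) = 1`) of `cz²φ′ + (1 − scz)φ = 0` at `z = 1` solves `N`,
hence `Λ̃(φ₀) = 0`, hence `t^{m+1}·Λ(t⁻¹φ₀) = 0`, so `t⁻¹φ₀` is a Laurent solution of `Λ` with a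
simple pole — impossible if every Laurent solution of `Λ` at `1` is a power series. PROVED.
[cite: FischlerRivoal2024, §5.1 (Proposition 4)] -/
theorem false_of_opA_opB_eq_zero (hc : c ≠ 0) (hs : ∀ n : ℕ, (s : ℚ) ≠ n) {m : ℕ}
    {Λ : ℕ → Polynomial ℂ} (hA : opA s c β m Λ = 0) (hB : opB s c β m Λ = 0)
    (hreg : ∀ y : LaurentSeries ℂ,
      (∑ k ∈ Finset.range (m + 1),
        ((((Λ k).comp (Polynomial.X + Polynomial.C 1) : Polynomial ℂ) : PowerSeries ℂ) :
          LaurentSeries ℂ) * (⇑(LaurentSeries.derivative ℂ))^[k] y = 0) →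
      ∃ y₀ : PowerSeries ℂ, (y₀ : LaurentSeries ℂ) = y) :
    False := by
  -- the local solution `φ₀` at `z = 1`
  set U : PowerSeries ℂ := (((Polynomial.C c * Polynomial.X ^ 2).comp
    (Polynomial.X + Polynomial.C 1) : Polynomial ℂ) : PowerSeries ℂ) with hU
  set V : PowerSeries ℂ := (((1 - Polynomial.C ((s : ℂ) * c) * Polynomial.X).comp
    (Polynomial.X + Polynomial.C 1) : Polynomial ℂ) : PowerSeries ℂ) with hV
  have hU0 : PowerSeries.constantCoeff U ≠ 0 := by
    rw [hU, ← PowerSeries.coeff_zero_eq_constantCoeff_apply, Polynomial.coeff_coe,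
      Polynomial.coeff_zero_eq_eval_zero]
    simpa using hc
  obtain ⟨φ₀, hφ0, hφ⟩ := exists_mul_derivative_eq_mul U (-V) hU0
  set y₁ : LaurentSeries ℂ := (φ₀ : LaurentSeries ℂ) with hy₁
  -- `E(y₁) = 0`, hence `N(y₁) = 0`
  have hE₁ : iota1 (Polynomial.C c * Polynomial.X ^ 2) * dee1 y₁
      + iota1 (1 - Polynomial.C ((s : ℂ) * c) * Polynomial.X) * y₁ = 0 := by
    rw [iota1_apply, iota1_apply, dee1_apply, hy₁, derivative_coe_powerSeries, ← hU, ← hV]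
    rw [← map_mul, ← map_mul, ← map_add, hφ]
    simp
  have hN₁ := FischlerRivoalCor1.nOp_eq_zero_of_E_eq_zero s c β iota1 dee1 dee1_leibniz dee1_iota1 hE₁
  have hred := pow_mul_opEval_eq_of_order_two iota1 dee1 dee1_leibniz dee1_iota1 _ _ _ hN₁ m
    (twistedOp m Λ)
  have hA' : iota1 (opA s c β m Λ) = 0 := by rw [hA, map_zero]
  have hB' : iota1 (opB s c β m Λ) = 0 := by rw [hB, map_zero]
  rw [opA] at hA'
  rw [opB] at hB'
  rw [hA', hB', zero_mul, zero_mul, add_zero] at hred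
  -- the twist with `w = t⁻¹ y₁`
  set t : LaurentSeries ℂ := iota1 (Polynomial.X - Polynomial.C 1) with ht
  have ht1 : t = HahnSeries.single 1 1 := iota1_X_sub_C_one
  have htinv : t * HahnSeries.single (-1) (1 : ℂ) = 1 := by
    rw [ht1, HahnSeries.single_mul_single]; simp
  have ht0 : t ≠ 0 := left_ne_zero_of_mul_eq_one htinv
  set w : LaurentSeries ℂ := HahnSeries.single (-1) (1 : ℂ) * y₁ with hw
  have htw : t * w = y₁ := by rw [hw, ← mul_assoc, htinv, one_mul]
  have htwist := twistedOp_spec iota1 dee1 dee1_leibniz dee1_iota1 m Λ w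
  rw [← ht, htw] at htwist
  -- `n₂ᵐ (X-1)^{m+1} Λ(w) = 0` in a field with nonzero prefactors
  have hzero : iota1 (FischlerRivoalCor1.nTwo s c β) ^ m * (iota1 ((Polynomial.X - Polynomial.C 1) ^ (m + 1))
      * ∑ k ∈ Finset.range (m + 1), iota1 (Λ k) * (⇑dee1)^[k] w) = 0 := by
    rw [htwist, hred]
  have hn2 : iota1 (FischlerRivoalCor1.nTwo s c β) ≠ 0 :=
    (map_ne_zero_iff _ iota1_injective).2 (FischlerRivoalCor1.nTwo_ne_zero s c β hc hs)
  have hXm : iota1 ((Polynomial.X - Polynomial.C 1) ^ (m + 1)) ≠ 0 := by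
    rw [map_pow, ← ht]; exact pow_ne_zero _ ht0
  have hΛw : ∑ k ∈ Finset.range (m + 1), iota1 (Λ k) * (⇑dee1)^[k] w = 0 := by
    rcases mul_eq_zero.1 hzero with h1 | h1
    · exact absurd (eq_zero_of_pow_eq_zero h1) hn2
    · rcases mul_eq_zero.1 h1 with h2 | h2
      · exact absurd h2 hXm
      · exact h2
  -- regularity: `w` would be a power series, but it has a pole
  obtain ⟨y₀, hy₀⟩ := hreg w hΛw
  have h1 : HahnSeries.coeff (y₀ : LaurentSeries ℂ) (-1) = 0 := by
    rw [coeff_coe_powerSeries_int, if_neg (by norm_num)]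
  have h2 : HahnSeries.coeff w (-1) = 1 := by
    rw [hw, hy₁, HahnSeries.coeff_single_mul, one_mul, sub_self,
      show ((0 : ℤ)) = ((0 : ℕ) : ℤ) by norm_num, LaurentSeries.coeff_coe_powerSeries,
      PowerSeries.coeff_zero_eq_constantCoeff_apply, hφ0]
  rw [hy₀, h2] at h1
  exact one_ne_zero h1

end FischlerRivoalCor1

/-! ### 8. Corollary 1 from Conjecture 2 and André's regularity of Э-operators at `z = 1` -/

open MeasureTheory Set Real FischlerRivoalCor1 in
/-- **Fischler–Rivoal's Corollary 1, PROVED from its two published inputs taken as hypotheses: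
Conjecture 2 (the fact's own antecedent) and ANDRÉ's theorem in the form "every Э-function is
annihilated by a non-zero linear differential operator with polynomial coefficients all of whose
formal Laurent-series solutions at `z = 1` are power series".** The latter is the Э-incarnation of
[Andre2000GevreyI] (E-operators have no non-trivial singularity outside `{0, ∞}`; by the Wronskian
bound the holomorphic basis at `1` exhausts the formal solutions) and replaces Proposition 4 of the
source; it is NOT in the tree, so it stays an explicit hypothesis `H` — with it, the named fact
`FischlerRivoal2024_corollary1` holds. The deduction is Beukers' (§5.1 of the source) made
formal and Ore-free: twist by `z − 1` (`twistedOp_spec`), reduce along the order-2 equation of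
`𝔤 = β − 𝔣(z/α)` (`pow_mul_opEval_eq_of_order_two`), exclude a first-order relation by the
non-rationality of `𝔣` (§6), and exclude the exact-division case with the local solution
`zˢe^{1/(cz)}` at `z = 1` in `ℂ((z−1))` (§7). PROVED (modulo the displayed `H`).
[cite: FischlerRivoal2024, Corollary 1 (§1, p. 4) and §5] -/
theorem FischlerRivoal2024_corollary1_of_andreRegularity
    (H : ∀ (b : ℕ → ℂ), IsStrictEFunction b →
      ∃ (m : ℕ) (Λ : ℕ → Polynomial ℂ), Λ m ≠ 0 ∧
        (∑ k ∈ Finset.range (m + 1),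
          (Λ k : PowerSeries ℂ) * (⇑(PowerSeries.derivative ℂ))^[k] (antiESeries b) = 0) ∧
        (∀ y : LaurentSeries ℂ,
          (∑ k ∈ Finset.range (m + 1),
            ((((Λ k).comp (Polynomial.X + Polynomial.C 1) : Polynomial ℂ) : PowerSeries ℂ) :
              LaurentSeries ℂ) * (⇑(LaurentSeries.derivative ℂ))^[k] y = 0) →
          ∃ y₀ : PowerSeries ℂ, (y₀ : LaurentSeries ℂ) = y)) :
    FischlerRivoal2024_corollary1 := by
  intro hC2 α hα hpos s hs
  rw [Transcendental]
  intro hw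
  set w : ℝ := ∫ t in Ioi (0 : ℝ), (t + α) ^ (s : ℝ) * Real.exp (-t) with hw_def
  set β : ℝ := α ^ (((-s : ℚ)) : ℝ) * w with hβ_def
  have hβalg : IsAlgebraic ℚ β := (isAlgebraic_rpow_ratCast hα hpos (-s)).mul hw
  have hI : (∫ t in Ioi (0 : ℝ), Real.exp (-t) * (1 + t / α) ^ (s : ℝ)) = β := by
    rw [hβ_def, hw_def, integral_add_rpow_mul_exp_neg_eq _ hpos, ← mul_assoc,
      show (((-s : ℚ)) : ℝ) = -(s : ℝ) by push_cast; ring, Real.rpow_neg hpos.le,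
      inv_mul_cancel₀ (Real.rpow_pos_of_pos hpos _).ne', one_mul]
  have hsum : IsBorelLaplaceSum (chooseSeq s ((α : ℂ)⁻¹)) 0 1 (β : ℂ) := by
    have h1 := (isAntiESum_zero_iff _ _ _).1 (isAntiESum_chooseSeq_inv_one s hpos)
    rwa [integral_cexp_mul_one_add_div_cpow_eq_ofReal s hpos, hI] at h1
  have hαC : IsAlgebraic ℚ ((α : ℂ)⁻¹) := by
    have : IsAlgebraic ℚ (α : ℂ) := by simpa using hα.algebraMap (A := ℂ)
    exact this.inv
  have hβC : IsAlgebraic ℚ (β : ℂ) := by simpa using hβalg.algebraMap (A := ℂ)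
  have hc0 : (α : ℂ)⁻¹ ≠ 0 := inv_ne_zero (by exact_mod_cast hpos.ne')
  -- `g = β − 𝔣(z/α)` is Э with `g₀(1) = 0`; Conjecture 2 divides it by `z − 1`
  have hg := isStrictEFunction_diffSeq s ((α : ℂ)⁻¹) (β : ℂ) hαC hβC
  have hd : (0 : ℝ) ∈ Ioo (-(Real.pi / 2)) (Real.pi / 2) :=
    ⟨by linarith [Real.pi_pos], by linarith [Real.pi_pos]⟩
  have h0 : IsAntiESum (fun n => (β : ℂ) * deltaZero n - chooseSeq s ((α : ℂ)⁻¹) n) 0 1 0 := by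
    rw [isAntiESum_zero_iff]
    have := (isBorelLaplaceSum_const_mul_deltaZero_one (β : ℂ) hd).sub hsum
    rwa [sub_self] at this
  obtain ⟨g₁, hg₁, hmul⟩ := hC2 _ hg 0 hd h0
  -- André at `z = 1` for the Э-function `g₁`
  obtain ⟨m, Λ, -, hann, hreg⟩ := H _ hg₁
  rw [antiESeries_coeff_div_factorial] at hann
  have hAB := opA_mul_add_opB_mul_eq_zero s _ _ hmul hann
  obtain ⟨hA, hB⟩ := eq_zero_of_mul_add_mul_derivative_eq_zero s _ _ hc0 hs hAB
  exact false_of_opA_opB_eq_zero s _ _ hc0 hs hA hB hreg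

end Literature.NumberTheory.Transcendental

end
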